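import Mathlib
import Summits.QuantumAdvantage.QuantumAdvantage.Theses.MobiusLadder
import Summits.QuantumAdvantage.QuantumAdvantage.Theorems.MobiusLadderLiouvilleOrthogonalTC0StubSqTransfer
import Summits.QuantumAdvantage.QuantumAdvantage.Theorems.MobiusLadderLiouvilleOrthogonalTC0StubSqIdentities
import Literature.NumberTheory.LFunctions.KalaiMoebiusConjectures
import Literature.NumberTheory.Sieve.MoebiusWalshCircuitsProofs
import Literature.Probability.RandomGraphs.LowDegree
import HarnessLib

/-!
# Crux `MobiusLadder.LiouvilleOrthogonalTC0` (stmt-QuantumAdvantage-1393) IS Kalai's `TC⁰` conjecture: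
`LiouvilleOrthogonalTC0 ↔ kalai_moebius_TC0` (the Möbius bridge, line `Sketch` v8.1)

Line `Sketch` (lead `prover-line-stmt-QuantumAdvantage-1393-c5-0`). The route states its rung R2 for the
Liouville function `λ` (because `L_λ ∈ BQP` is what the ladder needs), while the printed open problem —
G. Kalai's "TC⁰ prime number conjecture" (MathOverflow 57543, 2011; survey post 2024), catalogued in
the tree as the `@[conjecture]` `Literature.NumberTheory.LFunctions.kalai_moebius_TC0` — is about `μ`.
This file PROVES that the two are EQUIVALENT (neither side is asserted):

* `liouvilleOrthogonalTC0_of_moebius`, `moebiusOrthogonalTC0_of_liouville` — the two transfers, from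
  `stub_sqTransfer` (`TC⁰`-orthogonality of a bounded `g` passes to `N ↦ Σ_{e² ∣ N} h(e) g(N/e²)`:
  multiplication by the constant `e²` and comparison with a constant are `TC⁰`/`AC⁰` maps, so the
  dilated and truncated correlations are again correlations with poly-size constant-depth `tcBasis`
  circuits, `e ≤ D₀`; the `e > D₀` tail has `≤ 2ⁿ/D₀` terms) along `λ(N) = Σ_{e²∣N} μ(N/e²)`
  (`stub_lamOfMu`) and `μ(N) = Σ_{e²∣N} μ(e) λ(N/e²)` (`stub_muOfLam`);
* `circuitCorrelation_moebius_eq`, `kalai_moebius_TC0_iff` — the `LFunctions` vocabulary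
  (`circuitCorrelation`, cube-indexed, `+1` for `true`) versus the crux's (`range (2ⁿ)`, `sgn true = −1`);
* **`liouvilleOrthogonalTC0_iff_kalai : LiouvilleOrthogonalTC0 ↔ kalai_moebius_TC0`**.

Consequences for the programme: a refutation of either kills both (refuters may hunt explicit `TC⁰`
correlations with `μ` OR with `λ`); every partial rung proved for `λ` in this crux (depth one, Kane,
few-majority, symmetric-digital modulo `GelfondLiouvilleDecay`, …) transfers to `μ` whenever its class
is closed under the precompositions `m ↦ e²m` and truncations used here (all `TC⁰` classes defined by
depth and polynomial size are).
-/

set_option linter.dupNamespace false -- D-0017: single-problem summit ⇒ `QuantumAdvantage.QuantumAdvantage` by design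

noncomputable section

namespace Summit.QuantumAdvantage.QuantumAdvantage.Theorems.LiouvilleOrthogonalTC0

open Filter Finset
open Literature.Computability.Complexity
open Literature.Probability.RandomGraphs.LowDegree (sgn)
open Summit.QuantumAdvantage.QuantumAdvantage.Theses.MobiusLadder (LiouvilleOrthogonalTC0)

/-- **`μ ⊥ TC⁰ ⇒ λ ⊥ TC⁰`** (transfer with `h = 1` along `λ = μ ∗ 𝟙_□`, `stub_sqTransfer` +
`stub_lamOfMu`): Möbius randomness for poly-size constant-depth threshold circuits of the binary
digits implies the crux `LiouvilleOrthogonalTC0`. -/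
theorem liouvilleOrthogonalTC0_of_moebius
    (hμ : ∀ (d : ℕ) (p : Polynomial ℕ) (ε : ℝ), 0 < ε → ∀ᶠ n : ℕ in atTop, ∀ C : Circuit (Fin n),
      C.IsOver tcBasis → C.acDepth ≤ d → C.size ≤ p.eval n →
        |∑ N ∈ Finset.range (2 ^ n), ((ArithmeticFunction.moebius N : ℤ) : ℝ) *
            sgn (C.eval (fun i : Fin n => Nat.testBit N i))| ≤ ε * (2 : ℝ) ^ n) :
    LiouvilleOrthogonalTC0 := by
  unfold Summit.QuantumAdvantage.QuantumAdvantage.Theses.MobiusLadder.LiouvilleOrthogonalTC0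
  have h := stub_sqTransfer (fun N => ArithmeticFunction.moebius N) (fun _ => 1)
    (fun N => by exact_mod_cast ArithmeticFunction.abs_moebius_le_one) (fun _ => by simp) hμ
  have key : ∀ N : ℕ, (∑ e ∈ N.divisors.filter (fun e => e * e ∣ N),
      (1 : ℤ) * ArithmeticFunction.moebius (N / (e * e))) = ArithmeticFunction.liouville N := by
    intro N
    rcases eq_or_ne N 0 with rfl | hN
    · simp
    · rw [stub_lamOfMu N hN]; simp
  intro d p ε hε
  filter_upwards [h d p ε hε] with n hn C hB hd hs
  have := hn C hB hd hs
  simpa only [key] using this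

/-- **`λ ⊥ TC⁰ ⇒ μ ⊥ TC⁰`** (transfer with `h = μ` along `μ = λ ∗ (μ on square roots)`,
`stub_sqTransfer` + `stub_muOfLam`). -/
theorem moebiusOrthogonalTC0_of_liouville (hlam : LiouvilleOrthogonalTC0) :
    ∀ (d : ℕ) (p : Polynomial ℕ) (ε : ℝ), 0 < ε → ∀ᶠ n : ℕ in atTop, ∀ C : Circuit (Fin n),
      C.IsOver tcBasis → C.acDepth ≤ d → C.size ≤ p.eval n →
        |∑ N ∈ Finset.range (2 ^ n), ((ArithmeticFunction.moebius N : ℤ) : ℝ) *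
            sgn (C.eval (fun i : Fin n => Nat.testBit N i))| ≤ ε * (2 : ℝ) ^ n := by
  unfold Summit.QuantumAdvantage.QuantumAdvantage.Theses.MobiusLadder.LiouvilleOrthogonalTC0 at hlam
  have h := stub_sqTransfer (fun N => ArithmeticFunction.liouville N)
    (fun d => ArithmeticFunction.moebius d)
    (fun N => by
      by_cases hN : N = 0
      · subst hN; simp
      · rw [ArithmeticFunction.liouville_apply hN, abs_pow, abs_neg, abs_one, one_pow])
    (fun d => by exact_mod_cast ArithmeticFunction.abs_moebius_le_one) hlam
  have key : ∀ N : ℕ, (∑ e ∈ N.divisors.filter (fun e => e * e ∣ N),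
      (ArithmeticFunction.moebius e : ℤ) * ArithmeticFunction.liouville (N / (e * e))) =
        ArithmeticFunction.moebius N := by
    intro N
    rcases eq_or_ne N 0 with rfl | hN
    · simp
    · rw [stub_muOfLam N hN]
  intro d p ε hε
  filter_upwards [h d p ε hε] with n hn C hB hd hs
  have := hn C hB hd hs
  simpa only [key] using this

/-- The `LFunctions` correlation of `μ` with a circuit is minus the crux-style sum
(`circuitCorrelation` is cube-indexed with `+1` for `true`; the crux's sums run over `range (2ⁿ)` with
`sgn true = −1`). -/
theorem circuitCorrelation_moebius_eq {n : ℕ} (C : Circuit (Fin n)) :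
    Literature.NumberTheory.LFunctions.circuitCorrelation (fun m => ArithmeticFunction.moebius m) C =
      -∑ N ∈ Finset.range (2 ^ n), ((ArithmeticFunction.moebius N : ℤ) : ℝ) *
          sgn (C.eval (fun i : Fin n => Nat.testBit N i)) := by
  unfold Literature.NumberTheory.LFunctions.circuitCorrelation
  rw [Literature.NumberTheory.Sieve.MoebiusWalsh.sum_range_two_pow_eq_sum_cube
    (fun N => ((ArithmeticFunction.moebius N : ℤ) : ℝ) * sgn (C.eval (fun i : Fin n => Nat.testBit N i))),
    ← sum_neg_distrib]
  refine sum_congr rfl fun x _ => ?_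
  rw [Literature.NumberTheory.Sieve.MoebiusWalsh.ofFn_testBit_bitsToNat]
  cases C.eval x <;> simp [sgn]

/-- **Kalai's `TC⁰` conjecture for `μ` ⇔ the crux-style `μ`-statement** (vocabulary only). -/
theorem kalai_moebius_TC0_iff :
    Literature.NumberTheory.LFunctions.kalai_moebius_TC0 ↔
      ∀ (d : ℕ) (p : Polynomial ℕ) (ε : ℝ), 0 < ε → ∀ᶠ n : ℕ in atTop, ∀ C : Circuit (Fin n),
        C.IsOver tcBasis → C.acDepth ≤ d → C.size ≤ p.eval n →
          |∑ N ∈ Finset.range (2 ^ n), ((ArithmeticFunction.moebius N : ℤ) : ℝ) *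
              sgn (C.eval (fun i : Fin n => Nat.testBit N i))| ≤ ε * (2 : ℝ) ^ n := by
  unfold Literature.NumberTheory.LFunctions.kalai_moebius_TC0
  simp only [circuitCorrelation_moebius_eq, abs_neg]

/-- **The crux IS Kalai's `TC⁰` conjecture: `LiouvilleOrthogonalTC0 ↔ kalai_moebius_TC0`.** Möbius
randomness for non-uniform `TC⁰` (G. Kalai, MathOverflow 57543 (2011) / survey 2024, "The ACC(p)
and TC0 conjectures"; OPEN) is equivalent to its Liouville form, the route's rung R2. Neither side is
asserted. -/
theorem liouvilleOrthogonalTC0_iff_kalai :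
    LiouvilleOrthogonalTC0 ↔ Literature.NumberTheory.LFunctions.kalai_moebius_TC0 := by
  rw [kalai_moebius_TC0_iff]
  exact ⟨moebiusOrthogonalTC0_of_liouville, liouvilleOrthogonalTC0_of_moebius⟩

end Summit.QuantumAdvantage.QuantumAdvantage.Theorems.LiouvilleOrthogonalTC0
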